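import Summits.QuantumFields.BalabanUV.T4Continuum.Support.NE7EffectiveFormCoarseCurlAllLevels
import Summits.QuantumFields.BalabanUV.T4Continuum.Support.NE3LatticeWeitzenbock
import HarnessLib

/-!
# NE7EffectiveFormGaugeFixedCoercive — THE `(j+1)`-STEP EFFECTIVE QUADRATIC FORM PLUS THE COARSE LANDAU GAUGE-FIXING TERM DOMINATES THE FULL LATTICE GRADIENT ENERGY, CONSTANT ONE,
# UNIFORMLY IN `j`, `N`, `n` (`d = 4`, flat background): `⟨v, Δ_{j+1} v⟩ + Σ_x ‖(δṽ)(x)‖²_{HS∕n} ≥ Σ_x Σ_μ Σ_ν ‖ṽ(x + e_μ)_ν − ṽ(x)_ν‖²_{HS∕n}`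

Lineage `b2b-balaban-t4-ne7-p1` (CRUX PROVER NE7 #1 = OWNER of BINDER row NE7), generation 116.  The sharp lower bound ✓ `NE7EffectiveFormCoarseCurlAllLevels.effectiveForm_ge_coarse_curl_flat_allLevels'`
(`D²m(0)[v,v] ≥ Σ_P nhsNormSq (curl_1 ṽ P)`) combined with the flat lattice Weitzenböck identity ✓ `NE3LatticeWeitzenbock.weitzenbock_nhs_periodBox` (`Σ‖∇Y‖² = Σ‖curl_1 Y‖² + Σ‖δY‖²` over one
period; [Balaban1984PropagatorsI] (1.21) context).  WHAT ([folklore]; 0 def, 0 sorry):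
* **`effectiveForm_add_divSq_ge_grad_flat_allLevels`** (`L ≥ 2`, `0 < ε ≤ ε₀`, `N ≥ 1`, EVERY `j`, every `v ∈ skewSub 4 n N`):
  `Σ_{x ∈ [0,N)^4} Σ_μ Σ_ν nhsNormSq (ṽ(x+e_μ)_ν − ṽ(x)_ν) ≤ D²(minAct_{j+1} ∘ chart_1)(0)[v, v] + Σ_{x ∈ [0,N)^4} nhsNormSq (Σ_μ (ṽ(x)_μ − ṽ(x−e_μ)_μ))`
  — the quadratic form of the GAUGE-FIXED effective action (effective form + coarse Landau∕Feynman divergence penalty, both with coefficient one) is bounded below by the rough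
  (full-gradient) energy: the lattice shadow of «`Δ_k` + gauge fixing is elliptic».
* **`effectiveForm_ge_grad_landau_flat_allLevels`**: on the coarse LANDAU SLICE `Σ_μ (ṽ(x)_μ − ṽ(x − e_μ)_μ) = 0` the effective form alone dominates the full gradient energy,
  `Σ_x Σ_μ Σ_ν nhsNormSq (∇_μ ṽ_ν (x)) ≤ D²(minAct_{j+1} ∘ chart_1)(0)[v, v]` — `H¹`-coercivity modulo constants, uniformly in the level, the volume and the colour number.
HONEST FRAMING: flat datum; lower bounds only (no upper bound, no Poincaré∕mass term: the zero modes are the constants, ✓ `NE7EffectiveFormFlatZeroModes`); OUR minimisers (B11 (8) with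
`sfClass`); nothing of Bałaban's asserted; NOT NE7 as a spine node; spine 0∕9; NOT infinite volume, NOT mass gap, NOT BetaPertH, NOT Clay.
-/

set_option autoImplicit false

open scoped BigOperators Matrix Matrix.Norms.L2Operator Topology
open NormedSpace Finset

namespace Summit.QuantumFields.BalabanUV.T4Continuum.NE7EffectiveFormGaugeFixedCoercive

open Literature.MathematicalPhysics.QuantumFieldTheory.Balaban1983to89
open B7Prop1Explicit B7Prop2Explicit
open T4AveragingDeficitWall (curl curlAt)
open T4AveragingDeficitWallBoundary (periodBox)
open AveragingDeficitTorusChart (TDir chart chartDir isPeriodicDir_chartDir)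
open AveragingDeficitTwoLevelPrep (skewSub)
open MinimalActionLevels (perWin)
open MinimalActionSandwich (minAct)
open MinimalActionRate (sfClass)
open MinimalActionWitness (flatCfg)
open MatrixNorms (nhsNormSq nhsNormSq_nonneg)
open NE3LatticeWeitzenbock (weitzenbock_nhs_periodBox)
open NE7EffectiveFormCoarseCurlAllLevels (effectiveForm_ge_coarse_curl_flat_allLevels')

noncomputable section

variable {n : Type} [Fintype n] [DecidableEq n]

/-- The period-window curl energy is the box-and-plane double sum of `curlAt`. [folklore] -/
theorem sum_perWin_nhsNormSq_curl {d : ℕ} (N : ℕ) (V : Site d → Fin d → (Matrix n n ℂ)ˣ) (Y : Site d → Fin d → Matrix n n ℂ) :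
    ∑ P ∈ perWin d N, nhsNormSq (curl V Y P) = ∑ x ∈ periodBox N, ∑ π : T4AveragingDeficitWall.Plane d, nhsNormSq (curlAt V Y x π.1.1 π.1.2) := by
  rw [perWin, Finset.sum_product]
  rfl

/-- **GAUGE-FIXED COERCIVITY OF THE `(j+1)`-STEP EFFECTIVE FORM AT THE FLAT BACKGROUND** (`d = 4`, every `U(n)`, `L ≥ 2`): for `0 < ε ≤ ε₀`, `N ≥ 1`, every `j`, every `v ∈ skewSub 4 n N`,
`Σ_{x∈[0,N)^4} Σ_μ Σ_ν nhsNormSq (ṽ(x+e_μ)_ν − ṽ(x)_ν) ≤ D²(minAct 4 (sfClass 4 L N ε) L N (j+1) ∘ chart_1)(0)[v, v] + Σ_{x∈[0,N)^4} nhsNormSq (Σ_μ (ṽ(x)_μ − ṽ(x−e_μ)_μ))`. [folklore] -/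
theorem effectiveForm_add_divSq_ge_grad_flat_allLevels [Nonempty n] {L : ℕ} [NeZero L] (hL : 2 ≤ L) :
    ∃ ε₀ : ℝ, 0 < ε₀ ∧ ∀ ε : ℝ, 0 < ε → ε ≤ ε₀ → ∀ (N : ℕ) [NeZero N], 1 ≤ N → ∀ (j : ℕ) (v : ↥(skewSub 4 n N)),
      ∑ x ∈ periodBox N, ∑ μ : Fin 4, ∑ ν : Fin 4,
          nhsNormSq (chartDir (ContinuousLinearMap.id ℝ (Matrix n n ℂ)) N (v : TDir 4 n N) (x + e μ) ν - chartDir (ContinuousLinearMap.id ℝ (Matrix n n ℂ)) N (v : TDir 4 n N) x ν)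
        ≤ fderiv ℝ (fderiv ℝ (fun y : ↥(skewSub 4 n N) => minAct 4 (sfClass 4 L N ε) L N (j + 1)
            (chart (ContinuousLinearMap.id ℝ (Matrix n n ℂ)) N (flatCfg : Site 4 → Fin 4 → (Matrix n n ℂ)ˣ) (y : TDir 4 n N)))) 0 v v
          + ∑ x ∈ periodBox N, nhsNormSq (∑ μ : Fin 4,
              (chartDir (ContinuousLinearMap.id ℝ (Matrix n n ℂ)) N (v : TDir 4 n N) x μ - chartDir (ContinuousLinearMap.id ℝ (Matrix n n ℂ)) N (v : TDir 4 n N) (x - e μ) μ)) := by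
  obtain ⟨ε₀, hε₀, H⟩ := effectiveForm_ge_coarse_curl_flat_allLevels' (n := n) hL
  refine ⟨ε₀, hε₀, fun ε hε hεle N _ hN j v => ?_⟩
  have h := H ε hε hεle N hN j v
  rw [sum_perWin_nhsNormSq_curl] at h
  rw [weitzenbock_nhs_periodBox hN (isPeriodicDir_chartDir _ _ (v : TDir 4 n N))]
  exact add_le_add_left h _

/-- **LANDAU-SLICE `H¹`-COERCIVITY**: if `ṽ` is coarse-Landau (`Σ_μ (ṽ(x)_μ − ṽ(x − e_μ)_μ) = 0` at every site) then the effective form alone dominates the full gradient energy,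
`Σ_{x∈[0,N)^4} Σ_μ Σ_ν nhsNormSq (ṽ(x+e_μ)_ν − ṽ(x)_ν) ≤ D²(minAct_{j+1} ∘ chart_1)(0)[v, v]`, every `j`, `N`, `n`. [folklore] -/
theorem effectiveForm_ge_grad_landau_flat_allLevels [Nonempty n] {L : ℕ} [NeZero L] (hL : 2 ≤ L) :
    ∃ ε₀ : ℝ, 0 < ε₀ ∧ ∀ ε : ℝ, 0 < ε → ε ≤ ε₀ → ∀ (N : ℕ) [NeZero N], 1 ≤ N → ∀ (j : ℕ) (v : ↥(skewSub 4 n N)),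
      (∀ x : Site 4, ∑ μ : Fin 4,
          (chartDir (ContinuousLinearMap.id ℝ (Matrix n n ℂ)) N (v : TDir 4 n N) x μ - chartDir (ContinuousLinearMap.id ℝ (Matrix n n ℂ)) N (v : TDir 4 n N) (x - e μ) μ) = 0) →
      ∑ x ∈ periodBox N, ∑ μ : Fin 4, ∑ ν : Fin 4,
          nhsNormSq (chartDir (ContinuousLinearMap.id ℝ (Matrix n n ℂ)) N (v : TDir 4 n N) (x + e μ) ν - chartDir (ContinuousLinearMap.id ℝ (Matrix n n ℂ)) N (v : TDir 4 n N) x ν)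
        ≤ fderiv ℝ (fderiv ℝ (fun y : ↥(skewSub 4 n N) => minAct 4 (sfClass 4 L N ε) L N (j + 1)
            (chart (ContinuousLinearMap.id ℝ (Matrix n n ℂ)) N (flatCfg : Site 4 → Fin 4 → (Matrix n n ℂ)ˣ) (y : TDir 4 n N)))) 0 v v := by
  obtain ⟨ε₀, hε₀, H⟩ := effectiveForm_add_divSq_ge_grad_flat_allLevels (n := n) hL
  refine ⟨ε₀, hε₀, fun ε hε hεle N _ hN j v hdiv => ?_⟩
  have h := H ε hε hεle N hN j v
  have h0 : ∑ x ∈ periodBox N, nhsNormSq (∑ μ : Fin 4,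
      (chartDir (ContinuousLinearMap.id ℝ (Matrix n n ℂ)) N (v : TDir 4 n N) x μ - chartDir (ContinuousLinearMap.id ℝ (Matrix n n ℂ)) N (v : TDir 4 n N) (x - e μ) μ)) = 0 :=
    Finset.sum_eq_zero fun x _ => by rw [hdiv x]; simp [nhsNormSq]
  rw [h0, add_zero] at h
  exact h

end

end Summit.QuantumFields.BalabanUV.T4Continuum.NE7EffectiveFormGaugeFixedCoercive
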